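import Literature.Analysis.FluidPDE.SolenoidalTruncation
import Literature.Analysis.FluidPDE.NSVelocityUniqueness
import Literature.Analysis.FluidPDE.VorticityCalculus
import Literature.Analysis.FluidPDE.PineauVicolSliceEnstrophy
import HarnessLib

/-!
# Crux `ExtremiserTransience.NearExtremalTransience` (stmt-NavierStokesRegularity-21883), line `extremiser_liouville`,
# stub K1b — DENSITY LEAF, part 4b: `L²`-CONTINUITY OF ENSTROPHY, PALINSTROPHY AND STRETCHING

`--supports stmt-NavierStokesRegularity-21883` (helper).  Author: prover seat `ns-el-k1b` (g2).

For two smooth fields `u, v : ℝ³ → ℝ³` the three functionals of the crux —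
`Z = ∫‖curl ·‖²`, `P = ∫ |∇ curl ·|²_F`, `S = ∫⟪curl ·, D· (curl ·)⟫` — differ by at most
`C₁ e + C₂ √e √Q`, where `e` is the squared `L²` distance of the first (for `Z`, `S`) or second (for `P`) derivatives
of `u` and `v`, `Q` a fixed `L²` quantity of `v`, and `C₁, C₂` depend only on sup bounds (`‖curlCLM‖`, `sup‖Du‖`,
`sup‖Dv‖`).  Stated with extended norms (`‖∫φ_u − ∫φ_v‖ₑ ≤ …`), so that no finiteness bookkeeping is needed:

`enorm_integral_curl_sq_sub_le`, `enorm_integral_frobenius_sub_le`, `enorm_integral_stretching_sub_le`; they feed the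
density leaf of K1b (`…DensityLeaf`: `u = solenoidalTruncation (w − c) R`, `e → 0` by part 4a).
WHAT THIS IS NOT: nothing here is about Navier–Stokes solutions; the crux NET, rung N0 and NS regularity stay
OPEN — nothing here proves NS regularity. [folklore]
-/

noncomputable section

open Set Filter Topology MeasureTheory Metric Function
open scoped ENNReal NNReal Topology InnerProductSpace RealInnerProductSpace
open Literature.Analysis.FluidPDE Literature.Analysis

namespace Summit.NavierStokesRegularity.NavierStokesRegularity.Theorems

-- the problem directory repeats the summit name (`NavierStokesRegularity/NavierStokesRegularity`)
set_option linter.dupNamespace false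

namespace ExtremiserLiouville

/-! ## Pointwise algebra -/
/-- `|‖a‖² − ‖b‖²| ≤ ‖a − b‖² + 2‖a − b‖‖b‖`. [folklore] -/
theorem abs_norm_sq_sub_norm_sq_le {G : Type*} [NormedAddCommGroup G] (a b : G) :
    |‖a‖ ^ 2 - ‖b‖ ^ 2| ≤ ‖a - b‖ ^ 2 + 2 * ‖a - b‖ * ‖b‖ := by
  have h1 : ‖a‖ ≤ ‖a - b‖ + ‖b‖ := norm_le_norm_sub_add a b
  have h2 : ‖b‖ ≤ ‖a - b‖ + ‖a‖ := by
    have := norm_le_norm_sub_add b a; rwa [norm_sub_rev] at this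
  have hfac : ‖a‖ ^ 2 - ‖b‖ ^ 2 = (‖a‖ - ‖b‖) * (‖a‖ + ‖b‖) := by ring
  rw [hfac, abs_mul]
  have h3 : |‖a‖ - ‖b‖| ≤ ‖a - b‖ := by rw [abs_le]; constructor <;> linarith
  have h4 : |‖a‖ + ‖b‖| ≤ ‖a - b‖ + 2 * ‖b‖ := by
    rw [abs_of_nonneg (by positivity)]; linarith
  calc |‖a‖ - ‖b‖| * |‖a‖ + ‖b‖| ≤ ‖a - b‖ * (‖a - b‖ + 2 * ‖b‖) :=
        mul_le_mul h3 h4 (abs_nonneg _) (norm_nonneg _)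
    _ = ‖a - b‖ ^ 2 + 2 * ‖a - b‖ * ‖b‖ := by ring

/-- `|‖L₁‖²_F − ‖L₂‖²_F| ≤ 3 (‖L₁ − L₂‖² + 2‖L₁ − L₂‖‖L₂‖)` for the Frobenius norm on `ℝ³` (operator norms on the
right). [folklore] -/
theorem abs_frobeniusNormSq_sub_le (L₁ L₂ : EuclideanSpace ℝ (Fin 3) →L[ℝ] EuclideanSpace ℝ (Fin 3)) :
    |frobeniusNormSq L₁ - frobeniusNormSq L₂| ≤ 3 * (‖L₁ - L₂‖ ^ 2 + 2 * ‖L₁ - L₂‖ * ‖L₂‖) := by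
  set b := stdOrthonormalBasis ℝ (EuclideanSpace ℝ (Fin 3)) with hb
  rw [frobeniusNormSq_eq_sum b L₁, frobeniusNormSq_eq_sum b L₂, ← Finset.sum_sub_distrib]
  refine (Finset.abs_sum_le_sum_abs _ _).trans ?_
  have hterm : ∀ i, |‖L₁ (b i)‖ ^ 2 - ‖L₂ (b i)‖ ^ 2| ≤ ‖L₁ - L₂‖ ^ 2 + 2 * ‖L₁ - L₂‖ * ‖L₂‖ := by
    intro i
    have hbi : ‖b i‖ = 1 := b.orthonormal.1 i
    have hd : ‖L₁ (b i) - L₂ (b i)‖ ≤ ‖L₁ - L₂‖ := by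
      have := (L₁ - L₂).le_opNorm (b i)
      rw [hbi, mul_one] at this
      simpa using this
    have h2 : ‖L₂ (b i)‖ ≤ ‖L₂‖ := by
      have := L₂.le_opNorm (b i); rwa [hbi, mul_one] at this
    calc |‖L₁ (b i)‖ ^ 2 - ‖L₂ (b i)‖ ^ 2| ≤ ‖L₁ (b i) - L₂ (b i)‖ ^ 2 + 2 * ‖L₁ (b i) - L₂ (b i)‖ * ‖L₂ (b i)‖ :=
          abs_norm_sq_sub_norm_sq_le _ _
      _ ≤ ‖L₁ - L₂‖ ^ 2 + 2 * ‖L₁ - L₂‖ * ‖L₂‖ := by gcongr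
  calc ∑ i, |‖L₁ (b i)‖ ^ 2 - ‖L₂ (b i)‖ ^ 2| ≤ ∑ _i : Fin (Module.finrank ℝ (EuclideanSpace ℝ (Fin 3))),
        (‖L₁ - L₂‖ ^ 2 + 2 * ‖L₁ - L₂‖ * ‖L₂‖) := Finset.sum_le_sum fun i _ => hterm i
    _ = 3 * (‖L₁ - L₂‖ ^ 2 + 2 * ‖L₁ - L₂‖ * ‖L₂‖) := by
        rw [Finset.sum_const, Finset.card_univ, Fintype.card_fin, finrank_euclideanSpace_fin, nsmul_eq_mul]
        norm_num

/-- The stretching density is Lipschitz in `(curl, D)`: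
`|⟪a, D a⟫ − ⟪b, E b⟫| ≤ ‖D‖‖a−b‖² + (‖D‖ + ‖E‖)‖a−b‖‖b‖ + ‖b‖‖D−E‖‖a−b‖ + ‖b‖²‖D−E‖`. [folklore] -/
theorem abs_stretching_sub_le (a b : EuclideanSpace ℝ (Fin 3))
    (D E : EuclideanSpace ℝ (Fin 3) →L[ℝ] EuclideanSpace ℝ (Fin 3)) :
    |⟪a, D a⟫ - ⟪b, E b⟫| ≤ ‖D‖ * ‖a - b‖ ^ 2 + (‖D‖ + ‖E‖) * ‖a - b‖ * ‖b‖ + ‖b‖ * ‖D - E‖ * ‖a - b‖ +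
      ‖b‖ ^ 2 * ‖D - E‖ := by
  have hDEa : (D - E) a = D a - E a := rfl
  have hsplit : ⟪a, D a⟫ - ⟪b, E b⟫ = ⟪a - b, D a⟫ + ⟪b, (D - E) a⟫ + ⟪b, E (a - b)⟫ := by
    rw [hDEa]
    simp only [inner_sub_left, inner_sub_right, map_sub]
    ring
  rw [hsplit]
  have ha : ‖a‖ ≤ ‖a - b‖ + ‖b‖ := norm_le_norm_sub_add a b
  have t1 : |⟪a - b, D a⟫| ≤ ‖D‖ * ‖a - b‖ ^ 2 + ‖D‖ * ‖a - b‖ * ‖b‖ := by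
    calc |⟪a - b, D a⟫| ≤ ‖a - b‖ * ‖D a‖ := abs_real_inner_le_norm _ _
      _ ≤ ‖a - b‖ * (‖D‖ * ‖a‖) := by gcongr; exact D.le_opNorm a
      _ ≤ ‖a - b‖ * (‖D‖ * (‖a - b‖ + ‖b‖)) := by gcongr
      _ = ‖D‖ * ‖a - b‖ ^ 2 + ‖D‖ * ‖a - b‖ * ‖b‖ := by ring
  have t2 : |⟪b, (D - E) a⟫| ≤ ‖b‖ * ‖D - E‖ * ‖a - b‖ + ‖b‖ ^ 2 * ‖D - E‖ := by
    calc |⟪b, (D - E) a⟫| ≤ ‖b‖ * ‖(D - E) a‖ := abs_real_inner_le_norm _ _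
      _ ≤ ‖b‖ * (‖D - E‖ * ‖a‖) := by gcongr; exact (D - E).le_opNorm a
      _ ≤ ‖b‖ * (‖D - E‖ * (‖a - b‖ + ‖b‖)) := by gcongr
      _ = ‖b‖ * ‖D - E‖ * ‖a - b‖ + ‖b‖ ^ 2 * ‖D - E‖ := by ring
  have t3 : |⟪b, E (a - b)⟫| ≤ ‖E‖ * ‖a - b‖ * ‖b‖ := by
    calc |⟪b, E (a - b)⟫| ≤ ‖b‖ * ‖E (a - b)‖ := abs_real_inner_le_norm _ _
      _ ≤ ‖b‖ * (‖E‖ * ‖a - b‖) := by gcongr; exact E.le_opNorm _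
      _ = ‖E‖ * ‖a - b‖ * ‖b‖ := by ring
  calc |⟪a - b, D a⟫ + ⟪b, (D - E) a⟫ + ⟪b, E (a - b)⟫|
      ≤ |⟪a - b, D a⟫| + |⟪b, (D - E) a⟫| + |⟪b, E (a - b)⟫| := abs_add_three _ _ _
    _ ≤ _ := by linarith

/-! ## Derivative differences -/

section Derivs

variable {u v : EuclideanSpace ℝ (Fin 3) → EuclideanSpace ℝ (Fin 3)}

/-- `‖curl u(x) − curl v(x)‖ ≤ ‖curlCLM‖ ‖D¹(u − v)(x)‖`. [folklore] -/
theorem norm_curl_sub_le (hu : ContDiff ℝ 1 u) (hv : ContDiff ℝ 1 v) (x : EuclideanSpace ℝ (Fin 3)) :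
    ‖curl u x - curl v x‖ ≤ ‖curlCLM‖ * ‖iteratedFDeriv ℝ 1 (fun y => u y - v y) x‖ := by
  rw [← curl_sub ((hu.differentiable one_ne_zero) x) ((hv.differentiable one_ne_zero) x), norm_iteratedFDeriv_one]
  exact norm_curl_le _ x

/-- `‖D(curl u)(x) − D(curl v)(x)‖ ≤ ‖curlCLM‖ ‖D²(u − v)(x)‖`. [folklore] -/
theorem norm_fderiv_curl_sub_le (hu : ContDiff ℝ 2 u) (hv : ContDiff ℝ 2 v) (x : EuclideanSpace ℝ (Fin 3)) :
    ‖fderiv ℝ (curl u) x - fderiv ℝ (curl v) x‖ ≤ ‖curlCLM‖ * ‖iteratedFDeriv ℝ 2 (fun y => u y - v y) x‖ := by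
  have hcurl : curl (fun y => u y - v y) = fun y => curl u y - curl v y := funext fun y =>
    curl_sub ((hu.differentiable (by norm_num)) y) ((hv.differentiable (by norm_num)) y)
  have hcu : DifferentiableAt ℝ (curl u) x :=
    ((contDiff_curl (n := 1) (by exact_mod_cast hu)).differentiable one_ne_zero) x
  have hcv : DifferentiableAt ℝ (curl v) x :=
    ((contDiff_curl (n := 1) (by exact_mod_cast hv)).differentiable one_ne_zero) x
  have hD : fderiv ℝ (curl (fun y => u y - v y)) x = fderiv ℝ (curl u) x - fderiv ℝ (curl v) x := by
    rw [hcurl]; exact fderiv_fun_sub hcu hcv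
  rw [← hD]
  exact norm_fderiv_curl_le (hu.sub hv) x

end Derivs

/-! ## The three error bounds -/

section Errors

variable {u v : EuclideanSpace ℝ (Fin 3) → EuclideanSpace ℝ (Fin 3)}

/-- A real integrand dominated by a function with finite lower integral is integrable. [folklore] -/
theorem integrable_of_abs_le_of_lintegral {φ : EuclideanSpace ℝ (Fin 3) → ℝ} {G : EuclideanSpace ℝ (Fin 3) → ℝ≥0∞}
    (hφ : AEStronglyMeasurable φ volume) (hle : ∀ x, ENNReal.ofReal |φ x| ≤ G x) (hG : ∫⁻ x, G x < ⊤) :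
    Integrable φ volume := by
  refine ⟨hφ, ?_⟩
  refine lt_of_le_of_lt (lintegral_mono fun x => ?_) hG
  rw [Real.enorm_eq_ofReal_abs]
  exact hle x

/-- Compactly supported continuous real functions vanishing with `curl u`: integrability helper. [folklore] -/
theorem integrable_of_continuous_of_curl_support {u : EuclideanSpace ℝ (Fin 3) → EuclideanSpace ℝ (Fin 3)}
    (huc : HasCompactSupport u) {φ : EuclideanSpace ℝ (Fin 3) → ℝ} (hφ : Continuous φ)
    (h0 : ∀ x, curl u x = 0 → fderiv ℝ (curl u) x = 0 → φ x = 0) : Integrable φ volume := by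
  refine hφ.integrable_of_hasCompactSupport ?_
  have hc : HasCompactSupport (curl u) := hasCompactSupport_curl huc
  have hcd : HasCompactSupport (fderiv ℝ (curl u)) := hc.fderiv (𝕜 := ℝ)
  refine HasCompactSupport.intro (hc.union hcd) fun x hx => ?_
  rw [mem_union, not_or] at hx
  exact h0 x (image_eq_zero_of_notMem_tsupport hx.1) (image_eq_zero_of_notMem_tsupport hx.2)

/-- **Enstrophy is `L²`-continuous**: for smooth `u` (compactly supported) and `v` (`curl v ∈ L²`),
`‖Z(u) − Z(v)‖ₑ ≤ κ² e₁ + 2κ e₁^{1/2} Z̃(v)^{1/2}` with `κ = ‖curlCLM‖`, `e₁ = ∫‖D(u − v)‖²`,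
`Z̃(v) = ∫⁻‖curl v‖ₑ²`. [folklore] -/
theorem enorm_integral_curl_sq_sub_le (hu : ContDiff ℝ (⊤ : ℕ∞) u) (huc : HasCompactSupport u)
    (hv : ContDiff ℝ (⊤ : ℕ∞) v) (hZv : ∫⁻ x, ‖curl v x‖ₑ ^ 2 < ⊤) :
    ‖(∫ x, ‖curl u x‖ ^ 2) - ∫ x, ‖curl v x‖ ^ 2‖ₑ ≤
      ENNReal.ofReal (‖curlCLM‖ ^ 2) * (∫⁻ x, ‖iteratedFDeriv ℝ 1 (fun y => u y - v y) x‖ₑ ^ 2) +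
        2 * ENNReal.ofReal ‖curlCLM‖ * (∫⁻ x, ‖iteratedFDeriv ℝ 1 (fun y => u y - v y) x‖ₑ ^ 2) ^ (1 / 2 : ℝ) *
          (∫⁻ x, ‖curl v x‖ₑ ^ 2) ^ (1 / 2 : ℝ) := by
  set κ : ℝ := ‖curlCLM‖ with hκ
  have hκ0 : 0 ≤ κ := norm_nonneg curlCLM
  have hu1 : ContDiff ℝ 1 u := contDiff_infty.1 hu 1
  have hv1 : ContDiff ℝ 1 v := contDiff_infty.1 hv 1
  have cu : Continuous (curl u) := continuous_curl hu1
  have cv : Continuous (curl v) := continuous_curl hv1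
  have hdm : Measurable fun x => ‖iteratedFDeriv ℝ 1 (fun y => u y - v y) x‖ₑ := ((hu1.sub hv1).continuous_iteratedFDeriv le_rfl).enorm.measurable
  have hbm : Measurable fun x => ‖curl v x‖ₑ := cv.enorm.measurable
  have hiu : Integrable (fun x => ‖curl u x‖ ^ 2) volume :=
    integrable_of_continuous_of_curl_support huc ((cu.norm).pow 2) fun x hx _ => by simp [hx]
  have hiv : Integrable (fun x => ‖curl v x‖ ^ 2) volume := by
    refine integrable_of_abs_le_of_lintegral ((cv.norm).pow 2).aestronglyMeasurable (fun x => ?_) hZv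
    rw [abs_of_nonneg (by positivity), ENNReal.ofReal_pow (norm_nonneg _), ofReal_norm]
  have hsub : (∫ x, ‖curl u x‖ ^ 2) - ∫ x, ‖curl v x‖ ^ 2 = ∫ x, (‖curl u x‖ ^ 2 - ‖curl v x‖ ^ 2) :=
    (integral_sub hiu hiv).symm
  rw [hsub]
  refine (enorm_integral_le_lintegral_enorm _).trans ?_
  have hpt : ∀ x, ‖‖curl u x‖ ^ 2 - ‖curl v x‖ ^ 2‖ₑ ≤
      ENNReal.ofReal (κ ^ 2) * ‖iteratedFDeriv ℝ 1 (fun y => u y - v y) x‖ₑ ^ 2 + 2 * ENNReal.ofReal κ * (‖iteratedFDeriv ℝ 1 (fun y => u y - v y) x‖ₑ * ‖curl v x‖ₑ) := by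
    intro x
    have hab : ‖curl u x - curl v x‖ ≤ κ * ‖iteratedFDeriv ℝ 1 (fun y => u y - v y) x‖ := norm_curl_sub_le hu1 hv1 x
    set δ := ‖iteratedFDeriv ℝ 1 (fun y => u y - v y) x‖ with hδ
    have hreal : |‖curl u x‖ ^ 2 - ‖curl v x‖ ^ 2| ≤ κ ^ 2 * δ ^ 2 + 2 * κ * (δ * ‖curl v x‖) := by
      refine (abs_norm_sq_sub_norm_sq_le _ _).trans ?_
      have h1 : ‖curl u x - curl v x‖ ^ 2 ≤ (κ * δ) ^ 2 := pow_le_pow_left₀ (norm_nonneg _) hab 2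
      have h2 : 2 * ‖curl u x - curl v x‖ * ‖curl v x‖ ≤ 2 * (κ * δ) * ‖curl v x‖ := by gcongr
      nlinarith
    have hδ0 : 0 ≤ δ := norm_nonneg _
    have hδe : ENNReal.ofReal δ = ‖iteratedFDeriv ℝ 1 (fun y => u y - v y) x‖ₑ := by rw [hδ]; exact ofReal_norm _
    have hbe : ENNReal.ofReal ‖curl v x‖ = ‖curl v x‖ₑ := ofReal_norm _
    rw [Real.enorm_eq_ofReal_abs]
    refine (ENNReal.ofReal_le_ofReal hreal).trans (le_of_eq ?_)
    rw [ENNReal.ofReal_add (by positivity) (mul_nonneg (mul_nonneg (by norm_num) hκ0) (mul_nonneg hδ0 (norm_nonneg _))),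
      ENNReal.ofReal_mul (sq_nonneg κ), ENNReal.ofReal_pow hδ0, hδe,
      ENNReal.ofReal_mul (mul_nonneg (by norm_num) hκ0 : (0:ℝ) ≤ 2 * κ), ENNReal.ofReal_mul (by norm_num : (0:ℝ) ≤ 2),
      ENNReal.ofReal_mul hδ0, hδe, hbe, ENNReal.ofReal_ofNat]
  refine (lintegral_mono hpt).trans ?_
  rw [lintegral_add_left ((hdm.pow_const 2).const_mul _), lintegral_const_mul' _ _ ENNReal.ofReal_ne_top,
    lintegral_const_mul' _ _ (ENNReal.mul_ne_top (by norm_num) ENNReal.ofReal_ne_top)]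
  have hCS := lintegral_mul_le_sqrt_mul_sqrt hdm.aemeasurable hbm.aemeasurable
  calc ENNReal.ofReal (κ ^ 2) * (∫⁻ x, ‖iteratedFDeriv ℝ 1 (fun y => u y - v y) x‖ₑ ^ 2) + 2 * ENNReal.ofReal κ * (∫⁻ x, ‖iteratedFDeriv ℝ 1 (fun y => u y - v y) x‖ₑ * ‖curl v x‖ₑ)
      ≤ ENNReal.ofReal (κ ^ 2) * (∫⁻ x, ‖iteratedFDeriv ℝ 1 (fun y => u y - v y) x‖ₑ ^ 2) +
        2 * ENNReal.ofReal κ * ((∫⁻ x, ‖iteratedFDeriv ℝ 1 (fun y => u y - v y) x‖ₑ ^ 2) ^ (1 / 2 : ℝ) * (∫⁻ x, ‖curl v x‖ₑ ^ 2) ^ (1 / 2 : ℝ)) := by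
        gcongr
    _ = _ := by ring

/-- **Palinstrophy is `L²`-continuous**: for smooth `u` (compactly supported) and `v` (`D curl v ∈ L²`),
`‖P(u) − P(v)‖ₑ ≤ 3κ² e₂ + 6κ e₂^{1/2} P̃(v)^{1/2}`, `e₂ = ∫‖D²(u − v)‖²`, `P̃(v) = ∫⁻‖D(curl v)‖ₑ²`. [folklore] -/
theorem enorm_integral_frobenius_sub_le (hu : ContDiff ℝ (⊤ : ℕ∞) u) (huc : HasCompactSupport u)
    (hv : ContDiff ℝ (⊤ : ℕ∞) v) (hPv : ∫⁻ x, ‖fderiv ℝ (curl v) x‖ₑ ^ 2 < ⊤) :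
    ‖(∫ x, frobeniusNormSq (fderiv ℝ (curl u) x)) - ∫ x, frobeniusNormSq (fderiv ℝ (curl v) x)‖ₑ ≤
      3 * ENNReal.ofReal (‖curlCLM‖ ^ 2) * (∫⁻ x, ‖iteratedFDeriv ℝ 2 (fun y => u y - v y) x‖ₑ ^ 2) +
        6 * ENNReal.ofReal ‖curlCLM‖ * (∫⁻ x, ‖iteratedFDeriv ℝ 2 (fun y => u y - v y) x‖ₑ ^ 2) ^ (1 / 2 : ℝ) *
          (∫⁻ x, ‖fderiv ℝ (curl v) x‖ₑ ^ 2) ^ (1 / 2 : ℝ) := by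
  set κ : ℝ := ‖curlCLM‖ with hκ
  have hκ0 : 0 ≤ κ := norm_nonneg curlCLM
  have hu2 : ContDiff ℝ 2 u := contDiff_infty.1 hu 2
  have hv2 : ContDiff ℝ 2 v := contDiff_infty.1 hv 2
  have hcu1 : ContDiff ℝ 1 (curl u) := contDiff_curl (n := 1) (by exact_mod_cast hu2)
  have hcv1 : ContDiff ℝ 1 (curl v) := contDiff_curl (n := 1) (by exact_mod_cast hv2)
  have cfu : Continuous fun x => frobeniusNormSq (fderiv ℝ (curl u) x) := continuous_frobeniusNormSq_fderiv hcu1 one_ne_zero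
  have cfv : Continuous fun x => frobeniusNormSq (fderiv ℝ (curl v) x) := continuous_frobeniusNormSq_fderiv hcv1 one_ne_zero
  have cDv : Continuous (fderiv ℝ (curl v)) := hcv1.continuous_fderiv one_ne_zero
  have hdm : Measurable fun x => ‖iteratedFDeriv ℝ 2 (fun y => u y - v y) x‖ₑ := ((hu2.sub hv2).continuous_iteratedFDeriv le_rfl).enorm.measurable
  have hbm : Measurable fun x => ‖fderiv ℝ (curl v) x‖ₑ := cDv.enorm.measurable
  have hiu : Integrable (fun x => frobeniusNormSq (fderiv ℝ (curl u) x)) volume :=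
    integrable_of_continuous_of_curl_support huc cfu fun x _ hx => by rw [hx, frobeniusNormSq_zero]
  have hiv : Integrable (fun x => frobeniusNormSq (fderiv ℝ (curl v) x)) volume := by
    refine integrable_of_abs_le_of_lintegral cfv.aestronglyMeasurable (G := fun x => 3 * ‖fderiv ℝ (curl v) x‖ₑ ^ 2)
      (fun x => ?_) ?_
    · rw [abs_of_nonneg (frobeniusNormSq_nonneg _)]
      have h := ofReal_frobeniusNormSq_le_finrank_mul (E := EuclideanSpace ℝ (Fin 3)) (fderiv ℝ (curl v) x)
      rw [finrank_euclideanSpace_fin] at h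
      exact_mod_cast h
    · rw [lintegral_const_mul' _ _ (by norm_num)]
      exact ENNReal.mul_lt_top (by norm_num) hPv
  have hsub : (∫ x, frobeniusNormSq (fderiv ℝ (curl u) x)) - ∫ x, frobeniusNormSq (fderiv ℝ (curl v) x) =
      ∫ x, (frobeniusNormSq (fderiv ℝ (curl u) x) - frobeniusNormSq (fderiv ℝ (curl v) x)) := (integral_sub hiu hiv).symm
  rw [hsub]
  refine (enorm_integral_le_lintegral_enorm _).trans ?_
  have hpt : ∀ x, ‖frobeniusNormSq (fderiv ℝ (curl u) x) - frobeniusNormSq (fderiv ℝ (curl v) x)‖ₑ ≤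
      3 * ENNReal.ofReal (κ ^ 2) * ‖iteratedFDeriv ℝ 2 (fun y => u y - v y) x‖ₑ ^ 2 + 6 * ENNReal.ofReal κ * (‖iteratedFDeriv ℝ 2 (fun y => u y - v y) x‖ₑ * ‖fderiv ℝ (curl v) x‖ₑ) := by
    intro x
    have hab : ‖fderiv ℝ (curl u) x - fderiv ℝ (curl v) x‖ ≤ κ * ‖iteratedFDeriv ℝ 2 (fun y => u y - v y) x‖ :=
      norm_fderiv_curl_sub_le hu2 hv2 x
    set δ := ‖iteratedFDeriv ℝ 2 (fun y => u y - v y) x‖ with hδ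
    have hreal : |frobeniusNormSq (fderiv ℝ (curl u) x) - frobeniusNormSq (fderiv ℝ (curl v) x)| ≤
        3 * κ ^ 2 * δ ^ 2 + 6 * κ * (δ * ‖fderiv ℝ (curl v) x‖) := by
      refine (abs_frobeniusNormSq_sub_le _ _).trans ?_
      have h1 : ‖fderiv ℝ (curl u) x - fderiv ℝ (curl v) x‖ ^ 2 ≤ (κ * δ) ^ 2 :=
        pow_le_pow_left₀ (norm_nonneg _) hab 2
      have h2 : 2 * ‖fderiv ℝ (curl u) x - fderiv ℝ (curl v) x‖ * ‖fderiv ℝ (curl v) x‖ ≤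
          2 * (κ * δ) * ‖fderiv ℝ (curl v) x‖ := by gcongr
      nlinarith
    have hδ0 : 0 ≤ δ := norm_nonneg _
    have hδe : ENNReal.ofReal δ = ‖iteratedFDeriv ℝ 2 (fun y => u y - v y) x‖ₑ := by rw [hδ]; exact ofReal_norm _
    have hbe : ENNReal.ofReal ‖fderiv ℝ (curl v) x‖ = ‖fderiv ℝ (curl v) x‖ₑ := by
      exact ofReal_norm (fderiv ℝ (curl v) x)
    rw [Real.enorm_eq_ofReal_abs]
    refine (ENNReal.ofReal_le_ofReal hreal).trans (le_of_eq ?_)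
    rw [ENNReal.ofReal_add (by positivity) (mul_nonneg (mul_nonneg (by norm_num) hκ0) (mul_nonneg hδ0 (norm_nonneg _))),
      ENNReal.ofReal_mul (by positivity : (0:ℝ) ≤ 3 * κ ^ 2), ENNReal.ofReal_mul (by norm_num : (0:ℝ) ≤ 3),
      ENNReal.ofReal_pow hδ0, hδe,
      ENNReal.ofReal_mul (mul_nonneg (by norm_num) hκ0 : (0:ℝ) ≤ 6 * κ), ENNReal.ofReal_mul (by norm_num : (0:ℝ) ≤ 6),
      ENNReal.ofReal_mul hδ0, hδe, hbe, ENNReal.ofReal_ofNat, ENNReal.ofReal_ofNat]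
  refine (lintegral_mono hpt).trans ?_
  have hc1 : 3 * ENNReal.ofReal (κ ^ 2) ≠ ⊤ := ENNReal.mul_ne_top (by norm_num) ENNReal.ofReal_ne_top
  have hc2 : 6 * ENNReal.ofReal κ ≠ ⊤ := ENNReal.mul_ne_top (by norm_num) ENNReal.ofReal_ne_top
  rw [lintegral_add_left ((hdm.pow_const 2).const_mul _), lintegral_const_mul' _ _ hc1, lintegral_const_mul' _ _ hc2]
  have hCS := lintegral_mul_le_sqrt_mul_sqrt hdm.aemeasurable hbm.aemeasurable
  calc 3 * ENNReal.ofReal (κ ^ 2) * (∫⁻ x, ‖iteratedFDeriv ℝ 2 (fun y => u y - v y) x‖ₑ ^ 2) + 6 * ENNReal.ofReal κ * (∫⁻ x, ‖iteratedFDeriv ℝ 2 (fun y => u y - v y) x‖ₑ * ‖fderiv ℝ (curl v) x‖ₑ)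
      ≤ 3 * ENNReal.ofReal (κ ^ 2) * (∫⁻ x, ‖iteratedFDeriv ℝ 2 (fun y => u y - v y) x‖ₑ ^ 2) +
        6 * ENNReal.ofReal κ * ((∫⁻ x, ‖iteratedFDeriv ℝ 2 (fun y => u y - v y) x‖ₑ ^ 2) ^ (1 / 2 : ℝ) * (∫⁻ x, ‖fderiv ℝ (curl v) x‖ₑ ^ 2) ^ (1 / 2 : ℝ)) := by
        gcongr
    _ = _ := by ring

/-- **The stretching integral is `L²`-continuous under sup bounds**: for smooth `u` (compactly supported,
`‖Du‖ ≤ Bu`) and `v` (`‖Dv‖ ≤ Bv`, `curl v ∈ L²`), `‖S(u) − S(v)‖ₑ ≤ C₁ e₁ + C₂ e₁^{1/2} Z̃(v)^{1/2}` with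
`C₁ = κ²(Bu + Bv)`, `C₂ = κ(Bu + 3Bv)`, `κ = ‖curlCLM‖`. [folklore] -/
theorem enorm_integral_stretching_sub_le (hu : ContDiff ℝ (⊤ : ℕ∞) u) (huc : HasCompactSupport u)
    (hv : ContDiff ℝ (⊤ : ℕ∞) v) {Bu Bv : ℝ} (hBu : ∀ x, ‖fderiv ℝ u x‖ ≤ Bu) (hBv : ∀ x, ‖fderiv ℝ v x‖ ≤ Bv)
    (hZv : ∫⁻ x, ‖curl v x‖ₑ ^ 2 < ⊤) :
    ‖(∫ x, ⟪curl u x, fderiv ℝ u x (curl u x)⟫) - ∫ x, ⟪curl v x, fderiv ℝ v x (curl v x)⟫‖ₑ ≤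
      ENNReal.ofReal (‖curlCLM‖ ^ 2 * (Bu + Bv)) * (∫⁻ x, ‖iteratedFDeriv ℝ 1 (fun y => u y - v y) x‖ₑ ^ 2) +
        ENNReal.ofReal (‖curlCLM‖ * (Bu + 3 * Bv)) *
          (∫⁻ x, ‖iteratedFDeriv ℝ 1 (fun y => u y - v y) x‖ₑ ^ 2) ^ (1 / 2 : ℝ) *
            (∫⁻ x, ‖curl v x‖ₑ ^ 2) ^ (1 / 2 : ℝ) := by
  set κ : ℝ := ‖curlCLM‖ with hκ
  have hκ0 : 0 ≤ κ := norm_nonneg curlCLM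
  have hBu0 : 0 ≤ Bu := (norm_nonneg _).trans (hBu 0)
  have hBv0 : 0 ≤ Bv := (norm_nonneg _).trans (hBv 0)
  have hu1 : ContDiff ℝ 1 u := contDiff_infty.1 hu 1
  have hv1 : ContDiff ℝ 1 v := contDiff_infty.1 hv 1
  have cu : Continuous (curl u) := continuous_curl hu1
  have cv : Continuous (curl v) := continuous_curl hv1
  have cDu : Continuous (fderiv ℝ u) := hu.continuous_fderiv (by simp)
  have cDv : Continuous (fderiv ℝ v) := hv.continuous_fderiv (by simp)
  have hdm : Measurable fun x => ‖iteratedFDeriv ℝ 1 (fun y => u y - v y) x‖ₑ := ((hu1.sub hv1).continuous_iteratedFDeriv le_rfl).enorm.measurable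
  have hbm : Measurable fun x => ‖curl v x‖ₑ := cv.enorm.measurable
  have hiu : Integrable (fun x => ⟪curl u x, fderiv ℝ u x (curl u x)⟫) volume :=
    integrable_of_continuous_of_curl_support huc (cu.inner (cDu.clm_apply cu)) fun x hx _ => by simp [hx]
  have hiv : Integrable (fun x => ⟪curl v x, fderiv ℝ v x (curl v x)⟫) volume := by
    refine integrable_of_abs_le_of_lintegral (cv.inner (cDv.clm_apply cv)).aestronglyMeasurable
      (G := fun x => ENNReal.ofReal Bv * ‖curl v x‖ₑ ^ 2) (fun x => ?_) ?_
    · have h : |⟪curl v x, fderiv ℝ v x (curl v x)⟫| ≤ Bv * ‖curl v x‖ ^ 2 := by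
        calc |⟪curl v x, fderiv ℝ v x (curl v x)⟫| ≤ ‖curl v x‖ * ‖fderiv ℝ v x (curl v x)‖ :=
              abs_real_inner_le_norm _ _
          _ ≤ ‖curl v x‖ * (Bv * ‖curl v x‖) := by
              gcongr; exact (ContinuousLinearMap.le_opNorm _ _).trans (by gcongr; exact hBv x)
          _ = Bv * ‖curl v x‖ ^ 2 := by ring
      refine (ENNReal.ofReal_le_ofReal h).trans (le_of_eq ?_)
      rw [ENNReal.ofReal_mul hBv0, ENNReal.ofReal_pow (norm_nonneg _), ofReal_norm]
    · rw [lintegral_const_mul' _ _ ENNReal.ofReal_ne_top]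
      exact ENNReal.mul_lt_top ENNReal.ofReal_lt_top hZv
  have hsub : (∫ x, ⟪curl u x, fderiv ℝ u x (curl u x)⟫) - ∫ x, ⟪curl v x, fderiv ℝ v x (curl v x)⟫ =
      ∫ x, (⟪curl u x, fderiv ℝ u x (curl u x)⟫ - ⟪curl v x, fderiv ℝ v x (curl v x)⟫) := (integral_sub hiu hiv).symm
  rw [hsub]
  refine (enorm_integral_le_lintegral_enorm _).trans ?_
  have hpt : ∀ x, ‖⟪curl u x, fderiv ℝ u x (curl u x)⟫ - ⟪curl v x, fderiv ℝ v x (curl v x)⟫‖ₑ ≤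
      ENNReal.ofReal (κ ^ 2 * (Bu + Bv)) * ‖iteratedFDeriv ℝ 1 (fun y => u y - v y) x‖ₑ ^ 2 + ENNReal.ofReal (κ * (Bu + 3 * Bv)) * (‖iteratedFDeriv ℝ 1 (fun y => u y - v y) x‖ₑ * ‖curl v x‖ₑ) := by
    intro x
    have hab : ‖curl u x - curl v x‖ ≤ κ * ‖iteratedFDeriv ℝ 1 (fun y => u y - v y) x‖ := norm_curl_sub_le hu1 hv1 x
    set δ := ‖iteratedFDeriv ℝ 1 (fun y => u y - v y) x‖ with hδ
    have hδ0 : 0 ≤ δ := norm_nonneg _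
    have hDE : ‖fderiv ℝ u x - fderiv ℝ v x‖ = δ := by
      rw [hδ, norm_iteratedFDeriv_one,
        fderiv_fun_sub ((hu1.differentiable one_ne_zero) x) ((hv1.differentiable one_ne_zero) x)]
    have hb : ‖curl v x‖ ≤ κ * Bv := (norm_curl_le v x).trans (by gcongr; exact hBv x)
    have hreal : |⟪curl u x, fderiv ℝ u x (curl u x)⟫ - ⟪curl v x, fderiv ℝ v x (curl v x)⟫| ≤
        κ ^ 2 * (Bu + Bv) * δ ^ 2 + κ * (Bu + 3 * Bv) * (δ * ‖curl v x‖) := by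
      refine (abs_stretching_sub_le _ _ _ _).trans ?_
      rw [hDE]
      set m := ‖curl u x - curl v x‖ with hm
      set nb := ‖curl v x‖ with hnb
      have hm0 : 0 ≤ m := norm_nonneg _
      have hnb0 : 0 ≤ nb := norm_nonneg _
      have e1 : ‖fderiv ℝ u x‖ * m ^ 2 ≤ Bu * (κ * δ) ^ 2 := by
        gcongr
        · exact hBu x
      have e2 : (‖fderiv ℝ u x‖ + ‖fderiv ℝ v x‖) * m * nb ≤ (Bu + Bv) * (κ * δ) * nb := by
        gcongr
        · exact hBu x
        · exact hBv x
      have e3 : nb * δ * m ≤ nb * δ * (κ * δ) := by gcongr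
      have e4 : nb ^ 2 * δ ≤ (κ * Bv) * nb * δ := by
        rw [pow_two, mul_assoc, mul_assoc]; gcongr
      have e3' : nb * δ * (κ * δ) ≤ (κ * Bv) * δ * (κ * δ) := by gcongr
      nlinarith [mul_nonneg hκ0 hδ0, mul_nonneg hBv0 hδ0, mul_nonneg hnb0 hδ0]
    have hδe : ENNReal.ofReal δ = ‖iteratedFDeriv ℝ 1 (fun y => u y - v y) x‖ₑ := by rw [hδ]; exact ofReal_norm _
    have hbe : ENNReal.ofReal ‖curl v x‖ = ‖curl v x‖ₑ := ofReal_norm _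
    have hc1 : (0:ℝ) ≤ κ ^ 2 * (Bu + Bv) := mul_nonneg (sq_nonneg κ) (add_nonneg hBu0 hBv0)
    have hc2 : (0:ℝ) ≤ κ * (Bu + 3 * Bv) := mul_nonneg hκ0 (by linarith)
    rw [Real.enorm_eq_ofReal_abs]
    refine (ENNReal.ofReal_le_ofReal hreal).trans (le_of_eq ?_)
    rw [ENNReal.ofReal_add (mul_nonneg hc1 (sq_nonneg δ)) (mul_nonneg hc2 (mul_nonneg hδ0 (norm_nonneg _))),
      ENNReal.ofReal_mul hc1, ENNReal.ofReal_pow hδ0, hδe, ENNReal.ofReal_mul hc2, ENNReal.ofReal_mul hδ0, hδe, hbe]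
  refine (lintegral_mono hpt).trans ?_
  rw [lintegral_add_left ((hdm.pow_const 2).const_mul _), lintegral_const_mul' _ _ ENNReal.ofReal_ne_top,
    lintegral_const_mul' _ _ ENNReal.ofReal_ne_top]
  have hCS := lintegral_mul_le_sqrt_mul_sqrt hdm.aemeasurable hbm.aemeasurable
  calc ENNReal.ofReal (κ ^ 2 * (Bu + Bv)) * (∫⁻ x, ‖iteratedFDeriv ℝ 1 (fun y => u y - v y) x‖ₑ ^ 2) +
        ENNReal.ofReal (κ * (Bu + 3 * Bv)) * (∫⁻ x, ‖iteratedFDeriv ℝ 1 (fun y => u y - v y) x‖ₑ * ‖curl v x‖ₑ)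
      ≤ ENNReal.ofReal (κ ^ 2 * (Bu + Bv)) * (∫⁻ x, ‖iteratedFDeriv ℝ 1 (fun y => u y - v y) x‖ₑ ^ 2) +
        ENNReal.ofReal (κ * (Bu + 3 * Bv)) * ((∫⁻ x, ‖iteratedFDeriv ℝ 1 (fun y => u y - v y) x‖ₑ ^ 2) ^ (1 / 2 : ℝ) * (∫⁻ x, ‖curl v x‖ₑ ^ 2) ^ (1 / 2 : ℝ)) := by
        gcongr
    _ = _ := by ring

end Errors
end ExtremiserLiouville

end Summit.NavierStokesRegularity.NavierStokesRegularity.Theorems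

end
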